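import Mathlib
import Summits.NavierStokesRegularity.NavierStokesRegularity.Theorems.FilamentSkeletonRssStadiumDeviationRatio

/-!
# Route `FilamentSkeletonRss` · child crux `TangentSkeletonNearStraightL` (stmt-NavierStokesRegularity-23320) · registered line
# `child_tangent_analytic_strip_L` (b0b56c52900dd90a), stub `stub_stripPropagation` — brick: POINTWISE DEVIATION PROFILES ALONG A VERTICAL LEG

`Theorems.StadiumDeviationRatio` bounds the tangent deviations of the stadium-analytic extension `F` at ONE point `x + it` through ONE disc
ratio `n` (`q ≤ √3·M·log(n/(n−1))`, `e ≤ √3·2M(log(n/(n−1)) − 1/n)`).  The profile-form positivity bricks of this hand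
(`Theorems.StadiumSegmentProfile`, `Theorems.StadiumFootTangential`, `Theorems.StadiumPairAveraging`) consume CONTINUOUS pointwise profiles
`q(u)`, `e(u)` along a vertical leg `x + i[0,t]`; this file supplies them in the stub's own terms.  Fix an admissible disc radius `R` at
the foot (`0 < R < hs`, `|x − cc| + R < L + hs`); at height `u ∈ [0, R)` take the ratio `n = R/u`:
* `leg_profile_bounds` — `√Σ(Im F′ᵢ(x+iu))² ≤ √3·M·log(R/(R−u))` and `√Σ(Re F′ᵢ(x+iu) − ⟪X′(x),eᵢ⟫)² ≤ √3·2M·(log(R/(R−u)) − u/R)`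
  (`u = 0`: both sides vanish — `F′(x)` is the real tangent);
* `continuous_legQ`, `continuous_legE`, `leg_profiles` — the same majorants as GLOBALLY continuous functions of `u` (parameter clamped
  to `[0,t]`, `t < R`), bounding the deviations on `[0,t]`, ready for the `Continuous` hypotheses of the profile bricks;
* `integral_legE_eq`, `integral_legE_clamp_eq` — the closed form `∫₀ᵗ √3·2M(log(R/(R−u)) − u/R) du = √3·2M·(t − (R−t)·log(R/(R−t)) − t²/(2R))` (the `I`-term of
  the foot estimate; at the registered corner, `R = 3hs/4`, `t = hs/4`, `M = 2`: `0.039·hs`).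
HONEST FRAMING: elementary bricks for a plan about a HYPOTHETICAL filament skeleton on the NEGATIVE side of a MODEL route; the stub
`stub_stripPropagation` is NOT closed by this file; nothing here bears on Navier–Stokes regularity or blow-up.  `--supports stmt-NavierStokesRegularity-23320`.
-/

set_option linter.dupNamespace false

noncomputable section

namespace Summit.NavierStokesRegularity.NavierStokesRegularity.Theorems.StadiumLegProfiles

open Set MeasureTheory
open scoped InnerProductSpace BigOperators
open Summit.NavierStokesRegularity.NavierStokesRegularity.Theorems.StadiumDeviationRatio
open Summit.NavierStokesRegularity.NavierStokesRegularity.Theorems.StadiumDeviationPackage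

/-- **Pointwise deviation profiles along a vertical leg.**  Stadium `S = {|Im| < hs, |Re − cc| < L + hs}`, `F` differentiable on `S` with
`‖F′‖ ≤ M`, `F = cplx ∘ X` on the real trace (`X` differentiable); a foot `x` and an admissible disc radius `R` (`0 < R < hs`,
`|x − cc| + R < L + hs`).  Then at every height `0 ≤ u < R`:
`√Σ(Im F′ᵢ(x+iu))² ≤ √3·M·log(R/(R−u))` and `√Σ(Re F′ᵢ(x+iu) − ⟪X′(x),eᵢ⟫)² ≤ √3·2M·(log(R/(R−u)) − u/R)`. [folklore] -/
theorem leg_profile_bounds {hs L cc M : ℝ} {F : ℂ → (Fin 3 → ℂ)}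
    (hF : DifferentiableOn ℂ F {z : ℂ | |z.im| < hs ∧ |z.re - cc| < L + hs})
    (hM : ∀ z ∈ {z : ℂ | |z.im| < hs ∧ |z.re - cc| < L + hs}, ‖deriv F z‖ ≤ M)
    {X : ℝ → EuclideanSpace ℝ (Fin 3)} (hX : Differentiable ℝ X)
    (hFX : ∀ r : ℝ, (r : ℂ) ∈ {z : ℂ | |z.im| < hs ∧ |z.re - cc| < L + hs} →
      F r = fun i => ((⟪X r, EuclideanSpace.single i (1:ℝ)⟫_ℝ : ℝ) : ℂ))
    (hhs : 0 < hs) {x R u : ℝ} (hR : 0 < R) (hRhs : R < hs) (hRend : |x - cc| + R < L + hs)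
    (hu0 : 0 ≤ u) (huR : u < R) :
    √(∑ i, (deriv F ((x : ℂ) + (u : ℂ) * Complex.I) i).im ^ 2) ≤ √3 * (M * Real.log (R / (R - u))) ∧
    √(∑ i, ((deriv F ((x : ℂ) + (u : ℂ) * Complex.I) i).re - ⟪deriv X x, EuclideanSpace.single i (1:ℝ)⟫_ℝ) ^ 2) ≤
      √3 * (2 * M * (Real.log (R / (R - u)) - u / R)) := by
  have hx : |x - cc| < L + hs := by linarith
  rcases eq_or_lt_of_le hu0 with h0 | hupos
  · -- `u = 0`: the point is the real foot, both deviations vanish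
    subst h0
    have hreal := fun i => deriv_real_point hF hX hFX hhs hx i
    have e1 : ∑ i, (deriv F ((x : ℂ) + ((0:ℝ) : ℂ) * Complex.I) i).im ^ 2 = 0 := by
      have hpt : (x : ℂ) + ((0:ℝ) : ℂ) * Complex.I = (x : ℂ) := by simp
      rw [hpt]
      exact Finset.sum_eq_zero fun i _ => by rw [(hreal i).2]; ring
    have e2 : ∑ i, ((deriv F ((x : ℂ) + ((0:ℝ) : ℂ) * Complex.I) i).re -
        ⟪deriv X x, EuclideanSpace.single i (1:ℝ)⟫_ℝ) ^ 2 = 0 := by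
      have hpt : (x : ℂ) + ((0:ℝ) : ℂ) * Complex.I = (x : ℂ) := by simp
      rw [hpt]
      exact Finset.sum_eq_zero fun i _ => by rw [(hreal i).1]; ring
    rw [e1, e2, Real.sqrt_zero, sub_zero, div_self hR.ne', Real.log_one, zero_div, sub_zero]
    simp
  · -- `u > 0`: disc ratio `n = R/u`
    set n : ℝ := R / u with hn
    have hn1 : 1 < n := by rw [hn, lt_div_iff₀ hupos]; linarith
    have hnu : n * u = R := by rw [hn]; field_simp
    have hfit : n * u < hs := by rw [hnu]; exact hRhs
    have hfit' : |x - cc| + n * u < L + hs := by rw [hnu]; exact hRend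
    have hq := euclid_im_le_ratio hF hM hX hFX hn1 hu0 hfit hfit' hhs hx
    have he := euclid_re_dev_le_ratio hF hM hX hFX hn1 hu0 hfit hfit' hhs hx
    have hratio : n / (n - 1) = R / (R - u) := by
      have hRu : R - u ≠ 0 := by linarith
      rw [hn]
      field_simp
    have hinv : 1 / n = u / R := by rw [hn, one_div, inv_div]
    rw [hratio] at hq he
    rw [hinv] at he
    exact ⟨hq, he⟩

/-- The clamp of the parameter onto `[0, t]`. [folklore] -/
theorem clamp_mem {t : ℝ} (ht : 0 ≤ t) (u : ℝ) : max 0 (min u t) ∈ Icc (0:ℝ) t :=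
  ⟨le_max_left _ _, max_le ht (min_le_right _ _)⟩

/-- On `[0, t]` the clamp is the identity. [folklore] -/
theorem clamp_eq {t u : ℝ} (hu : u ∈ Icc (0:ℝ) t) : max 0 (min u t) = u := by
  rw [min_eq_left hu.2, max_eq_right hu.1]

/-- The clamp is continuous. [folklore] -/
theorem continuous_clamp (t : ℝ) : Continuous fun u : ℝ => max 0 (min u t) :=
  continuous_const.max (continuous_id.min continuous_const)

/-- **The imaginary profile as a globally continuous function** (`t < R`): `u ↦ √3·M·log(R/(R − clamp u))`. [folklore] -/
theorem continuous_legQ (M : ℝ) {R t : ℝ} (ht : 0 ≤ t) (htR : t < R) :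
    Continuous fun u : ℝ => √3 * (M * Real.log (R / (R - max 0 (min u t)))) := by
  have hden : ∀ u : ℝ, R - max 0 (min u t) ≠ 0 := fun u => by
    have := (clamp_mem ht u).2; intro h; linarith
  have hpos : ∀ u : ℝ, R / (R - max 0 (min u t)) ≠ 0 := fun u => by
    have h1 : 0 < R - max 0 (min u t) := by have := (clamp_mem ht u).2; linarith
    have hR : 0 < R := by linarith
    exact (div_pos hR h1).ne'
  refine continuous_const.mul (continuous_const.mul ?_)
  exact ((continuous_const.div (continuous_const.sub (continuous_clamp t)) hden).log hpos)

/-- **The real-part profile as a globally continuous function** (`t < R`): `u ↦ √3·2M·(log(R/(R − clamp u)) − clamp u / R)`. [folklore] -/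
theorem continuous_legE (M : ℝ) {R t : ℝ} (ht : 0 ≤ t) (htR : t < R) :
    Continuous fun u : ℝ => √3 * (2 * M * (Real.log (R / (R - max 0 (min u t))) - max 0 (min u t) / R)) := by
  have hden : ∀ u : ℝ, R - max 0 (min u t) ≠ 0 := fun u => by
    have := (clamp_mem ht u).2; intro h; linarith
  have hpos : ∀ u : ℝ, R / (R - max 0 (min u t)) ≠ 0 := fun u => by
    have h1 : 0 < R - max 0 (min u t) := by have := (clamp_mem ht u).2; linarith
    have hR : 0 < R := by linarith
    exact (div_pos hR h1).ne'
  refine continuous_const.mul (continuous_const.mul (Continuous.sub ?_ ((continuous_clamp t).div_const R)))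
  exact ((continuous_const.div (continuous_const.sub (continuous_clamp t)) hden).log hpos)

/-- **Leg profiles, packaged for the profile bricks.**  Under the hypotheses of `leg_profile_bounds` and for a leg height `0 ≤ t < R`, the
clamped profiles bound the deviations at every `u ∈ [0,t]` (`t < R`). [folklore] -/
theorem leg_profiles {hs L cc M : ℝ} {F : ℂ → (Fin 3 → ℂ)}
    (hF : DifferentiableOn ℂ F {z : ℂ | |z.im| < hs ∧ |z.re - cc| < L + hs})
    (hM : ∀ z ∈ {z : ℂ | |z.im| < hs ∧ |z.re - cc| < L + hs}, ‖deriv F z‖ ≤ M)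
    {X : ℝ → EuclideanSpace ℝ (Fin 3)} (hX : Differentiable ℝ X)
    (hFX : ∀ r : ℝ, (r : ℂ) ∈ {z : ℂ | |z.im| < hs ∧ |z.re - cc| < L + hs} →
      F r = fun i => ((⟪X r, EuclideanSpace.single i (1:ℝ)⟫_ℝ : ℝ) : ℂ))
    (hhs : 0 < hs) {x R t : ℝ} (hR : 0 < R) (hRhs : R < hs) (hRend : |x - cc| + R < L + hs) (htR : t < R) :
    (∀ u ∈ Icc (0:ℝ) t, √(∑ i, (deriv F ((x : ℂ) + (u : ℂ) * Complex.I) i).im ^ 2) ≤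
        √3 * (M * Real.log (R / (R - max 0 (min u t))))) ∧
    (∀ u ∈ Icc (0:ℝ) t, √(∑ i, ((deriv F ((x : ℂ) + (u : ℂ) * Complex.I) i).re -
        ⟪deriv X x, EuclideanSpace.single i (1:ℝ)⟫_ℝ) ^ 2) ≤
        √3 * (2 * M * (Real.log (R / (R - max 0 (min u t))) - max 0 (min u t) / R))) := by
  refine ⟨fun u hu => ?_, fun u hu => ?_⟩
  · rw [clamp_eq hu]
    exact (leg_profile_bounds hF hM hX hFX hhs hR hRhs hRend hu.1 (lt_of_le_of_lt hu.2 htR)).1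
  · rw [clamp_eq hu]
    exact (leg_profile_bounds hF hM hX hFX hhs hR hRhs hRend hu.1 (lt_of_le_of_lt hu.2 htR)).2

/-- **Closed form of the `I`-integral**: `∫₀ᵗ (log(R/(R−u)) − u/R) du = t − (R−t)·log(R/(R−t)) − t²/(2R)` for `0 ≤ t < R`. [folklore] -/
theorem integral_log_ratio_sub_eq {R t : ℝ} (ht : 0 ≤ t) (htR : t < R) :
    ∫ u in (0:ℝ)..t, (Real.log (R / (R - u)) - u / R) = t - (R - t) * Real.log (R / (R - t)) - t ^ 2 / (2 * R) := by
  have hIcc : uIcc (0:ℝ) t = Icc 0 t := uIcc_of_le ht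
  have hR : 0 < R := lt_of_le_of_lt ht htR
  -- antiderivative `G(u) = u − (R−u)(log R − log(R−u)) − u²/(2R)`
  have hder : ∀ u ∈ uIcc (0:ℝ) t,
      HasDerivAt (fun u : ℝ => u - (R - u) * (Real.log R - Real.log (R - u)) - u ^ 2 / (2 * R))
        (Real.log (R / (R - u)) - u / R) u := by
    intro u hu
    rw [hIcc] at hu
    have hpos : 0 < R - u := by linarith [hu.2]
    have h1 : HasDerivAt (fun u : ℝ => R - u) (-1) u := (hasDerivAt_id u).const_sub R
    have h2 : HasDerivAt (fun u : ℝ => Real.log (R - u)) (-1 / (R - u)) u := by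
      have h := h1.log hpos.ne'
      simpa [div_eq_mul_inv, neg_mul, one_mul] using h
    have h3 : HasDerivAt (fun u : ℝ => Real.log R - Real.log (R - u)) (0 - (-1 / (R - u))) u :=
      (hasDerivAt_const u (Real.log R)).sub h2
    have h4 : HasDerivAt (fun u : ℝ => (R - u) * (Real.log R - Real.log (R - u)))
        ((-1) * (Real.log R - Real.log (R - u)) + (R - u) * (0 - (-1 / (R - u)))) u := h1.mul h3
    have h5 : HasDerivAt (fun u : ℝ => u ^ 2 / (2 * R)) (2 * u / (2 * R)) u := by
      have h := ((hasDerivAt_id u).pow 2).div_const (2 * R)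
      simpa using h
    have h6 := (((hasDerivAt_id u).sub h4).sub h5)
    refine h6.congr_deriv ?_
    rw [Real.log_div hR.ne' hpos.ne']
    field_simp
    ring
  have hcont : ContinuousOn (fun u : ℝ => Real.log (R / (R - u)) - u / R) (uIcc (0:ℝ) t) := by
    rw [hIcc]
    refine ContinuousOn.sub ?_ (continuousOn_id.div_const R)
    refine ContinuousOn.log (continuousOn_const.div (continuousOn_const.sub continuousOn_id) fun u hu => ?_) fun u hu => ?_
    · have : 0 < R - u := by linarith [hu.2]
      exact this.ne'
    · have h1 : 0 < R - u := by linarith [hu.2]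
      exact (div_pos hR h1).ne'
  rw [intervalIntegral.integral_eq_sub_of_hasDerivAt hder hcont.intervalIntegrable]
  have hRt : 0 < R - t := by linarith
  rw [Real.log_div hR.ne' hRt.ne']
  simp only [sub_zero, sub_self, mul_zero]
  ring

/-- **The `I`-term of the foot estimate in closed form**: `∫₀ᵗ √3·2M(log(R/(R−u)) − u/R) du = √3·2M·(t − (R−t)log(R/(R−t)) − t²/(2R))`. [folklore] -/
theorem integral_legE_eq (M : ℝ) {R t : ℝ} (ht : 0 ≤ t) (htR : t < R) :
    ∫ u in (0:ℝ)..t, √3 * (2 * M * (Real.log (R / (R - u)) - u / R)) =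
      √3 * (2 * M * (t - (R - t) * Real.log (R / (R - t)) - t ^ 2 / (2 * R))) := by
  have h1 : (fun u : ℝ => √3 * (2 * M * (Real.log (R / (R - u)) - u / R))) =
      fun u => (√3 * (2 * M)) * (Real.log (R / (R - u)) - u / R) := by
    funext u; ring
  rw [h1, intervalIntegral.integral_const_mul, integral_log_ratio_sub_eq ht htR]
  ring

/-- The clamped `E`-profile integrates to the same closed form on `[0,t]`. [folklore] -/
theorem integral_legE_clamp_eq (M : ℝ) {R t : ℝ} (ht : 0 ≤ t) (htR : t < R) :
    ∫ u in (0:ℝ)..t, √3 * (2 * M * (Real.log (R / (R - max 0 (min u t))) - max 0 (min u t) / R)) =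
      √3 * (2 * M * (t - (R - t) * Real.log (R / (R - t)) - t ^ 2 / (2 * R))) := by
  rw [← integral_legE_eq M ht htR]
  refine intervalIntegral.integral_congr fun u hu => ?_
  rw [uIcc_of_le ht] at hu
  simp only [clamp_eq hu]

/-! ## Appended (same hand): the `J`-term of the foot estimate in closed form

`J(t) = ∫₀ᵗ q·e = 6M²·∫₀ᵗ ℓ(ℓ − u/R) du`, `ℓ(u) = log(R/(R−u))`, with
`∫₀ᵗ ℓ(ℓ − u/R) = 2t − (R−t)ℓ(t)² − 2(R−t)ℓ(t) + (R²−t²)ℓ(t)/(2R) − t/2 − t²/(4R)`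
(at the registered corner `R = 3hs/4`, `t = hs/4`, `M = 2`: `J = 0.040·hs`, against the full smear `∫₀ᵗ q = 0.13·hs`). -/

/-- **Closed form of the `J`-integral**: for `0 ≤ t < R`,
`∫₀ᵗ log(R/(R−u))·(log(R/(R−u)) − u/R) du = 2t − (R−t)·log²(R/(R−t)) − 2(R−t)·log(R/(R−t)) + (R²−t²)·log(R/(R−t))/(2R) − t/2 − t²/(4R)`.
[folklore] -/
theorem integral_log_ratio_mul_eq {R t : ℝ} (ht : 0 ≤ t) (htR : t < R) :
    ∫ u in (0:ℝ)..t, Real.log (R / (R - u)) * (Real.log (R / (R - u)) - u / R) =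
      2 * t - (R - t) * Real.log (R / (R - t)) ^ 2 - 2 * (R - t) * Real.log (R / (R - t)) +
        (R ^ 2 - t ^ 2) * Real.log (R / (R - t)) / (2 * R) - t / 2 - t ^ 2 / (4 * R) := by
  have hIcc : uIcc (0:ℝ) t = Icc 0 t := uIcc_of_le ht
  have hR : 0 < R := lt_of_le_of_lt ht htR
  -- antiderivative in terms of `ℓ(u) = log R − log (R − u)`
  set G : ℝ → ℝ := fun u => 2 * u - (R - u) * (Real.log R - Real.log (R - u)) ^ 2
      - 2 * (R - u) * (Real.log R - Real.log (R - u)) + (R ^ 2 - u ^ 2) * (Real.log R - Real.log (R - u)) / (2 * R)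
      - u / 2 - u ^ 2 / (4 * R) with hG
  have hder : ∀ u ∈ uIcc (0:ℝ) t,
      HasDerivAt G (Real.log (R / (R - u)) * (Real.log (R / (R - u)) - u / R)) u := by
    intro u hu
    rw [hIcc] at hu
    have hpos : 0 < R - u := by linarith [hu.2]
    have h1 : HasDerivAt (fun u : ℝ => R - u) (-1) u := (hasDerivAt_id u).const_sub R
    have hℓ : HasDerivAt (fun u : ℝ => Real.log R - Real.log (R - u)) (1 / (R - u)) u := by
      have h2 : HasDerivAt (fun u : ℝ => Real.log (R - u)) (-1 / (R - u)) u := by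
        have h := h1.log hpos.ne'
        simpa [div_eq_mul_inv, neg_mul, one_mul] using h
      have h3 := (hasDerivAt_const u (Real.log R)).sub h2
      refine h3.congr_deriv ?_
      ring
    -- the five pieces
    have hA : HasDerivAt (fun u : ℝ => 2 * u) 2 u := by
      simpa using (hasDerivAt_id u).const_mul 2
    have hB : HasDerivAt (fun u : ℝ => (R - u) * (Real.log R - Real.log (R - u)) ^ 2)
        ((-1) * (Real.log R - Real.log (R - u)) ^ 2 +
          (R - u) * (2 * (Real.log R - Real.log (R - u)) * (1 / (R - u)))) u := by
      have hsq := hℓ.pow 2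
      have := h1.mul hsq
      refine this.congr_deriv ?_
      simp [pow_one]
    have hC : HasDerivAt (fun u : ℝ => 2 * (R - u) * (Real.log R - Real.log (R - u)))
        (2 * (-1) * (Real.log R - Real.log (R - u)) + 2 * (R - u) * (1 / (R - u))) u := by
      have := (h1.const_mul 2).mul hℓ
      refine this.congr_deriv ?_
      ring
    have hD : HasDerivAt (fun u : ℝ => (R ^ 2 - u ^ 2) * (Real.log R - Real.log (R - u)) / (2 * R))
        (((-(2 * u)) * (Real.log R - Real.log (R - u)) + (R ^ 2 - u ^ 2) * (1 / (R - u))) / (2 * R)) u := by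
      have hsq : HasDerivAt (fun u : ℝ => R ^ 2 - u ^ 2) (-(2 * u)) u := by
        have h := ((hasDerivAt_id u).pow 2).const_sub (R ^ 2)
        simpa using h
      exact (hsq.mul hℓ).div_const (2 * R)
    have hE : HasDerivAt (fun u : ℝ => u / 2) (1 / 2) u := by
      simpa using (hasDerivAt_id u).div_const 2
    have hF : HasDerivAt (fun u : ℝ => u ^ 2 / (4 * R)) (2 * u / (4 * R)) u := by
      have h := ((hasDerivAt_id u).pow 2).div_const (4 * R)
      simpa using h
    have hsum := ((((hA.sub hB).sub hC).add hD).sub hE).sub hF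
    have hGeq : G = fun u => 2 * u - (R - u) * (Real.log R - Real.log (R - u)) ^ 2
        - 2 * (R - u) * (Real.log R - Real.log (R - u)) + (R ^ 2 - u ^ 2) * (Real.log R - Real.log (R - u)) / (2 * R)
        - u / 2 - u ^ 2 / (4 * R) := rfl
    rw [hGeq]
    refine hsum.congr_deriv ?_
    rw [Real.log_div hR.ne' hpos.ne']
    field_simp
    ring
  have hcont : ContinuousOn (fun u : ℝ => Real.log (R / (R - u)) * (Real.log (R / (R - u)) - u / R)) (uIcc (0:ℝ) t) := by
    rw [hIcc]
    have hlog : ContinuousOn (fun u : ℝ => Real.log (R / (R - u))) (Icc (0:ℝ) t) := by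
      refine ContinuousOn.log (continuousOn_const.div (continuousOn_const.sub continuousOn_id) fun u hu => ?_) fun u hu => ?_
      · have : 0 < R - u := by linarith [hu.2]
        exact this.ne'
      · have h1 : 0 < R - u := by linarith [hu.2]
        exact (div_pos hR h1).ne'
    exact hlog.mul (hlog.sub (continuousOn_id.div_const R))
  rw [intervalIntegral.integral_eq_sub_of_hasDerivAt hder hcont.intervalIntegrable]
  have hRt : 0 < R - t := by linarith
  simp only [hG, Real.log_div hR.ne' hRt.ne', sub_zero, sub_self, mul_zero]
  ring

/-- **The `J`-term in closed form**: `∫₀ᵗ (√3·M·log(R/(R−u)))·(√3·2M(log(R/(R−u)) − u/R)) du = 6M²·(closed form above)`. [folklore] -/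
theorem integral_legQE_eq (M : ℝ) {R t : ℝ} (ht : 0 ≤ t) (htR : t < R) :
    ∫ u in (0:ℝ)..t, (√3 * (M * Real.log (R / (R - u)))) * (√3 * (2 * M * (Real.log (R / (R - u)) - u / R))) =
      6 * M ^ 2 * (2 * t - (R - t) * Real.log (R / (R - t)) ^ 2 - 2 * (R - t) * Real.log (R / (R - t)) +
        (R ^ 2 - t ^ 2) * Real.log (R / (R - t)) / (2 * R) - t / 2 - t ^ 2 / (4 * R)) := by
  have h3 : Real.sqrt 3 * Real.sqrt 3 = 3 := Real.mul_self_sqrt (by norm_num)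
  have h1 : (fun u : ℝ => (√3 * (M * Real.log (R / (R - u)))) * (√3 * (2 * M * (Real.log (R / (R - u)) - u / R)))) =
      fun u => (6 * M ^ 2) * (Real.log (R / (R - u)) * (Real.log (R / (R - u)) - u / R)) := by
    funext u
    have : √3 * (M * Real.log (R / (R - u))) * (√3 * (2 * M * (Real.log (R / (R - u)) - u / R))) =
        (Real.sqrt 3 * Real.sqrt 3) * (2 * M ^ 2) * (Real.log (R / (R - u)) * (Real.log (R / (R - u)) - u / R)) := by ring
    rw [this, h3]; ring
  rw [h1, intervalIntegral.integral_const_mul, integral_log_ratio_mul_eq ht htR]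

/-! ## Appended (same hand): profiles along a HORIZONTAL CHORD with a position-dependent disc radius

On a plateau chord at height `Y` the admissible disc radius varies with the foot (`R(x) = min(hs, L + hs − |x − cc|)` up to margins); the
profile bricks want the deviations bounded by CONTINUOUS functions of the chord parameter.  Given any continuous radius profile `Rf` with
`Y < Rf r < hs` and `|x(r) − cc| + Rf r < L + hs` along the chord `x(r) = x₀ + r·s`, the pointwise lemma `leg_profile_bounds` (radius `Rf r`,
height `Y`) gives the bounds, and the composed profiles are continuous. -/

/-- Continuity of the composed imaginary profile `r ↦ √3·M·log(Rf r/(Rf r − Y))` for a continuous radius profile with `Y < Rf r`, `0 ≤ Y`. [folklore] -/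
theorem continuous_chordQ (M : ℝ) {Y : ℝ} (hY : 0 ≤ Y) {Rf : ℝ → ℝ} (hRc : Continuous Rf) (hRY : ∀ r, Y < Rf r) :
    Continuous fun r : ℝ => √3 * (M * Real.log (Rf r / (Rf r - Y))) := by
  have hden : ∀ r, Rf r - Y ≠ 0 := fun r => by have := hRY r; intro h; linarith
  have hpos : ∀ r, Rf r / (Rf r - Y) ≠ 0 := fun r => by
    have h1 : 0 < Rf r - Y := by linarith [hRY r]
    have h2 : 0 < Rf r := by linarith [hRY r]
    exact (div_pos h2 h1).ne'
  exact continuous_const.mul (continuous_const.mul ((hRc.div (hRc.sub continuous_const) hden).log hpos))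

/-- Continuity of the composed real-part profile `r ↦ √3·2M·(log(Rf r/(Rf r − Y)) − Y/Rf r)`. [folklore] -/
theorem continuous_chordE (M : ℝ) {Y : ℝ} (hY : 0 ≤ Y) {Rf : ℝ → ℝ} (hRc : Continuous Rf) (hRY : ∀ r, Y < Rf r) :
    Continuous fun r : ℝ => √3 * (2 * M * (Real.log (Rf r / (Rf r - Y)) - Y / Rf r)) := by
  have hden : ∀ r, Rf r - Y ≠ 0 := fun r => by have := hRY r; intro h; linarith
  have hR0 : ∀ r, Rf r ≠ 0 := fun r => by have := hRY r; intro h; linarith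
  have hpos : ∀ r, Rf r / (Rf r - Y) ≠ 0 := fun r => by
    have h1 : 0 < Rf r - Y := by linarith [hRY r]
    have h2 : 0 < Rf r := by linarith [hRY r]
    exact (div_pos h2 h1).ne'
  refine continuous_const.mul (continuous_const.mul (Continuous.sub ?_ (continuous_const.div hRc hR0)))
  exact (hRc.div (hRc.sub continuous_const) hden).log hpos

/-- **Profiles along a horizontal chord.**  Stadium hypotheses as in `leg_profile_bounds`; a chord `x(r) = x₀ + r·s` at height `0 ≤ Y` and a
radius profile `Rf` with `Y < Rf r`, `Rf r < hs`, `|x(r) − cc| + Rf r < L + hs` for `r ∈ [0,1]`: the deviations at `x(r) + iY` are bounded by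
the composed profiles. [folklore] -/
theorem chord_profiles {hs L cc M : ℝ} {F : ℂ → (Fin 3 → ℂ)}
    (hF : DifferentiableOn ℂ F {z : ℂ | |z.im| < hs ∧ |z.re - cc| < L + hs})
    (hM : ∀ z ∈ {z : ℂ | |z.im| < hs ∧ |z.re - cc| < L + hs}, ‖deriv F z‖ ≤ M)
    {X : ℝ → EuclideanSpace ℝ (Fin 3)} (hX : Differentiable ℝ X)
    (hFX : ∀ r : ℝ, (r : ℂ) ∈ {z : ℂ | |z.im| < hs ∧ |z.re - cc| < L + hs} →
      F r = fun i => ((⟪X r, EuclideanSpace.single i (1:ℝ)⟫_ℝ : ℝ) : ℂ))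
    (hhs : 0 < hs) {x₀ s Y : ℝ} (hY : 0 ≤ Y) {Rf : ℝ → ℝ}
    (hRY : ∀ r ∈ Icc (0:ℝ) 1, Y < Rf r) (hRhs : ∀ r ∈ Icc (0:ℝ) 1, Rf r < hs)
    (hRend : ∀ r ∈ Icc (0:ℝ) 1, |x₀ + r * s - cc| + Rf r < L + hs) :
    (∀ r ∈ Icc (0:ℝ) 1, √(∑ i, (deriv F (((x₀ + r * s : ℝ) : ℂ) + (Y : ℂ) * Complex.I) i).im ^ 2) ≤
        √3 * (M * Real.log (Rf r / (Rf r - Y)))) ∧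
    (∀ r ∈ Icc (0:ℝ) 1, √(∑ i, ((deriv F (((x₀ + r * s : ℝ) : ℂ) + (Y : ℂ) * Complex.I) i).re -
        ⟪deriv X (x₀ + r * s), EuclideanSpace.single i (1:ℝ)⟫_ℝ) ^ 2) ≤
        √3 * (2 * M * (Real.log (Rf r / (Rf r - Y)) - Y / Rf r))) := by
  refine ⟨fun r hr => ?_, fun r hr => ?_⟩
  · exact (leg_profile_bounds hF hM hX hFX hhs (lt_of_le_of_lt hY (hRY r hr)) (hRhs r hr) (hRend r hr) hY (hRY r hr)).1
  · exact (leg_profile_bounds hF hM hX hFX hhs (lt_of_le_of_lt hY (hRY r hr)) (hRhs r hr) (hRend r hr) hY (hRY r hr)).2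

end Summit.NavierStokesRegularity.NavierStokesRegularity.Theorems.StadiumLegProfiles

end
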